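import Literature.NumberTheory.PAdicHodge.AinfRamifiedOmegaPeriod
import Literature.NumberTheory.PAdicHodge.AinfWeierstrassOmegaPeriodNonvanishing
import HarnessLib

/-!
# (L1′) over the ramified base: `∫_t ω = 0 ⟹ [t] = 0` for Fontaine's element of a Tate-module point of a formal group over
# `𝒪_D = ℤ_p[ϖ]`

Topic `Literature/NumberTheory/PAdicHodge`; THEOREMS ONLY. The ramified twin of §1 (L1) of
`AinfWeierstrassOmegaPeriodNonvanishing` (case `𝒪 = ℤ_p`): for a Weierstrass equation `W` over `𝒪_D`, a `p`-adic field `F ∋ ϖ`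
and `t ∈ T_p Ŵ(𝒪_{ℂ_F})`, the ω-period `∫_t ω = log_W(ι_𝒪[t])` (tree `AinfRamTop.omegaPeriod`) vanishes only if Fontaine's
element `[t] ∈ A_inf(𝒪)` vanishes:

  `log_W(X) = X · (1 + X · G₁(X))`, and `1 + x·G₁(x)` is a unit of the local ring `B_dR⁺` for `x = ι_𝒪[t] ∈ Fil¹`; so
  `log_W(ι_𝒪[t]) = 0` forces `ι_𝒪[t] = 0`, hence `[t] = 0` by the INJECTIVITY of `ι_𝒪 : A_inf(𝒪) → B_dR⁺`
  (tree `AinfRam.toBdR_injective`, which replaces `𝔸_inf ∩ Fil^k = ξ^k𝔸_inf` of the unramified case).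

Together with the `ϖ`-adic descent lemma (tree `AinfRam.eq_zero_of_natCast_mul_eq_pow_mul`, the ramified (L2′)) this is the
ring-side input of the non-vanishing (N1′) of the ω-period on the K★ cells; the remaining input (`[p][t] = 0` in `Ŵ(𝔫_𝒪)` has the
shape `p[t]·R + [t]^{p²}·S = 0` at supersingular reduction) is coefficient-side. No definitions, no named facts, no `sorry`.
BSD / K★: nothing about elliptic curves over number fields is proved here.

## References
* J.-M. Fontaine, *Formes différentielles et modules de Tate…*, Invent. Math. 65 (1982), §5. [Fontaine1982FormesDifferentielles]
* J.-M. Fontaine, Astérisque 223 (1994), Exp. II §1.5.2–1.5.4. [FontaineAsterisque223III]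
* J. H. Silverman, *The Arithmetic of Elliptic Curves* (2009), IV.5.5. [SilvermanAEC2009]
-/

noncomputable section

open Ideal Field ValuativeRel

namespace Literature.NumberTheory.PAdicHodge

open Literature.NumberTheory.GaloisRepresentations
open Literature.NumberTheory.GaloisRepresentations.IsNonarchimedeanLocalField
open Literature.NumberTheory.GaloisRepresentations.LubinTate

namespace AinfRamTop

variable {F : Type} [Field F] [ValuativeRel F] [TopologicalSpace F] [IsNonarchimedeanLocalField F] [CharZero F]
  {p : ℕ} [Fact p.Prime] [Fact (¬ IsUnit (p : integerC F))] [IsAdicComplete (Ideal.span {(p : integerC F)}) (integerC F)]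
  {hp : valuation F p < 1} {D : EisensteinRoot F p hp}
  {hθ : Function.Surjective (WittVector.fontaineTheta (integerC F) p)} (W : WeierstrassCurve (EisensteinRoot.CoeffDisc D))

/-- `evalAt x X = x` on `Fil¹ B_dR⁺`, for `F`-coefficient series. [cite: FontaineAsterisque223III, Exp. II §1.5.4] -/
theorem evalAt_filOne_X (x : (BdRPlusTop.filOne F p).toIdeal) :
    evalAt (BdRPlusTop.filOne F p) x (PowerSeries.X : PowerSeries (FieldCoeff hp hθ)) = (x : BdRPlusTop F p) := by
  rw [← coe_evalPt₁_eq_evalAt (BdRPlusTop.filOne F p) PowerSeries.X PowerSeries.constantCoeff_X x]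
  exact congrArg Subtype.val (evalPt_X (BdRPlusTop.filOne F p) () (fun _ => x))

/-- `log_W = X + O(X²)`: the linear coefficient of `logSeries` is `1`. [cite: SilvermanAEC2009, IV.5.5] -/
theorem coeff_one_logSeries : PowerSeries.coeff 1 (logSeries hθ W) = 1 := by
  rw [logSeries, PowerSeries.coeff_map, WeierstrassCurve.coeff_one_formalLog, map_one]

/-- **(L1′) `∫_t ω = 0 ⟹ [t] = 0` over the ramified base**: `∫_t ω = log_W(ι_𝒪[t])` with `log_W(X) = X·(1 + X·G₁(X))`, and
`1 + x G₁(x)` is a unit of `B_dR⁺` for `x = ι_𝒪[t] ∈ Fil¹`; so `log_W(ι_𝒪[t]) = 0` forces `ι_𝒪[t] = 0`, hence `[t] = 0` in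
`A_inf(𝒪)` by injectivity of `ι_𝒪`. [cite: Fontaine1982FormesDifferentielles, §5] [cite: SilvermanAEC2009, IV.5.5] -/
theorem torsionLift_eq_zero_of_omegaPeriod_eq_zero {t : ℕ → (maxNilIdealC F).toIdeal} (ht0 : (t 0 : CBall F) = 0)
    (htp : ∀ n, mulPC W (t (n + 1)) = t n) (h : omegaPeriod W hθ t ht0 htp = 0) :
    torsionLift W hθ t htp = 0 := by
  -- `log_W = X · (1 + X · G₁)`
  obtain ⟨G, hG⟩ := PowerSeries.X_dvd_iff.mpr (constantCoeff_logSeries (hθ := hθ) W)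
  have hG0 : PowerSeries.constantCoeff G = 1 := by
    have h1 : PowerSeries.coeff 1 (logSeries hθ W) = 1 := coeff_one_logSeries W
    rw [hG, PowerSeries.coeff_succ_X_mul, PowerSeries.coeff_zero_eq_constantCoeff] at h1
    exact h1
  obtain ⟨G₁, hG₁⟩ := PowerSeries.X_dvd_iff.mpr
    (show PowerSeries.constantCoeff (G - 1) = 0 by rw [map_sub, hG0, map_one, sub_self])
  have hlog : logSeries hθ W = PowerSeries.X * (1 + PowerSeries.X * G₁) := by rw [← hG₁, add_sub_cancel, hG]
  set x := torsionLiftFil W hθ t ht0 htp with hxdef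
  -- evaluate
  have heval : omegaPeriod W hθ t ht0 htp =
      (x : BdRPlusTop F p) * (1 + evalAt (BdRPlusTop.filOne F p) x (PowerSeries.X * G₁)) := by
    rw [omegaPeriod, coe_evalPt₁_eq_evalAt, hlog, map_mul, map_add, map_one, evalAt_filOne_X]
  have hmem : evalAt (BdRPlusTop.filOne F p) x (PowerSeries.X * G₁) ∈ (BdRPlusTop.filOne F p).toIdeal := by
    rw [← coe_evalPt₁_eq_evalAt (BdRPlusTop.filOne F p) (PowerSeries.X * G₁)
      (by rw [map_mul, PowerSeries.constantCoeff_X, zero_mul]) x]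
    exact (evalPt₁ (BdRPlusTop.filOne F p) (PowerSeries.X * G₁) _ x).2
  have hunit := AinfTop.isUnit_one_add_of_mem_filOne hθ hmem
  have hx0 : (x : BdRPlusTop F p) = 0 := by
    rw [h] at heval
    exact hunit.mul_left_eq_zero.1 heval.symm
  rw [hxdef, coe_torsionLiftFil] at hx0
  have h2 : AinfRam.toBdR D hθ ((of D).symm (torsionLift W hθ t htp)) = 0 :=
    (BdRPlusTop.of F p).injective (by rw [hx0, map_zero])
  have h3 := AinfRam.toBdR_injective D hθ (by rw [h2, map_zero] : AinfRam.toBdR D hθ ((of D).symm (torsionLift W hθ t htp)) =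
    AinfRam.toBdR D hθ 0)
  rw [RingEquiv.map_eq_zero_iff] at h3
  exact h3

end AinfRamTop

end Literature.NumberTheory.PAdicHodge

end
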